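import Summits.Ventures.HodgeRepro.Tier3DiagonalCharacters

/-!
# The rational projector onto the Weil line is a `ℚ`-linear combination of the diagonal operators `⋀ⁿ(A′ b)`,
`b ∈ K^ι` — LEMMA-R-RESIDUE.md (S2) «the orbit projector is a `ℚ`-rational element of `R = F^{⊗ 2p}`» as linear algebra

Blind re-derivation cell `pub-hodge-repro`, seat `t3-p4` (Tier 3, T3.5 for T3.4 = Lemma R).  Target tree path
`lean/Summits/Ventures/HodgeRepro/Tier3ProjectorCorrespondence.lean`; imports the cell's `Tier3DiagonalCharacters`
(hence `Tier3LemmaRWeilLine`, `Tier3LemmaRAbstract`, `Tier3WeilProjector` and everything below them).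

WHAT THIS FILE STATES (LEMMA-R-RESIDUE.md §4(c): «`e := Σ_σ e_{(σ,…,σ)} ∈ R ⊗ ℚ^al` … is fixed by `Gal`, hence
`e ∈ R ⊗ 1 = R`: the projector of `K ⊗ ℂ` onto `⊕_σ K_{(σ,…,σ)} = W_F(B) ⊗ ℂ` is the action of a `ℚ`-RATIONAL element
`e ∈ R`, i.e. a `ℚ`-linear combination of pull-backs along endomorphisms of `B`»).  On `V_B` with `K`-basis
`ω′ : ι → V_B`, the diagonal action `A′ b` (`ω′_i ↦ b_i • ω′_i`, `b ∈ K^ι`), an eigenbasis `e′` of `K ⊗ V_B` with its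
wedge basis `E′`, the `σ`-lines `U σ` and an `F₀`-linear `e₀ : ⋀ⁿ V_B → ⋀ⁿ V_B` whose base change is the coordinate
projection onto the `σ`-line wedges (`Tier3WeilProjector.exists_rational_projector`, `n = |ι|`):

* `rTensor_baseChange_rTensor_inv` — `(τ ⊗ 1) ∘ (1 ⊗ f) ∘ (τ⁻¹ ⊗ 1) = 1 ⊗ f` for `F₀`-linear `f`;
* `baseChange_eq_sum_smul_baseChange_diag` — over `K`: `1 ⊗ e₀ = Σ_m λ_m • ⋀ⁿ(1 ⊗ A′ b_m)` with `λ_m ∈ K`, from the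
  indicator of the `σ`-lines in the `K`-span of the eigenvalue vectors (`Tier3DiagonalCharacters`);
* **`exists_eq_sum_smul_map_diag`** — over `F₀`: `e₀ = Σ_m q_m • ⋀ⁿ(A′ b_m)` with `q_m ∈ F₀` — the trace average
  `Σ_τ (τ ⊗ 1) ∘ (y • ·) ∘ (τ⁻¹ ⊗ 1)` with `Tr_{K/F₀}(y) = 1` turns the `K`-coefficients into the traces
  `q_m = Tr(y λ_m) ∈ F₀`;
* `diag_comp_diag`, `map_comp_eq_sum_smul_map_diag` — the same for `act(a) ∘ e₀` (`act(a) = ⋀ⁿ` of the first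
  corner's multiplication by `a`): `act(a) ∘ e₀ = Σ_m q_m • ⋀ⁿ(A′ ((a at i₀, 1 elsewhere) · b_m))`.

Read with `V_B = H¹(B, ℚ)`: every `⋀ⁿ(A′ b)` is the pull-back `(ι_1(b_1), …, ι_{2p}(b_{2p}))^*` along an endomorphism
of `B` (S1, definitional), so `e₀` and `act(a) ∘ e₀` are `ℚ`-linear combinations of pull-backs along endomorphisms
of `B` — LEMMA-R-RESIDUE.md's (S2) and the `act(a)`-clause of (S1), with nothing left on paper but «`⋀ⁿ(A′ b)` IS
that pull-back».

HONESTY.  Finite linear algebra on the cell's own modules; no definition is introduced; nothing geometric is built.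
HC_CM is NOT proved by anyone in this repository.
-/

set_option autoImplicit false

open TensorProduct Finset

namespace HodgeRepro.Tier3

open HodgeRepro.RouteC HodgeRepro.CMHodgeOn

/-! ### §1 Conjugation by `τ ⊗ 1` fixes base-changed maps -/

section Conj

variable {F₀ K : Type*} [Field F₀] [Field K] [Algebra F₀ K]
variable {X : Type*} [AddCommGroup X] [Module F₀ X]

/-- `(τ ⊗ 1) ((1 ⊗ f) ((τ⁻¹ ⊗ 1) z)) = (1 ⊗ f) z` for an `F₀`-linear `f : X → X`. -/
theorem rTensor_baseChange_rTensor_inv (f : X →ₗ[F₀] X) (τ : K ≃ₐ[F₀] K) (z : K ⊗[F₀] X) :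
    LinearMap.rTensor X τ.toLinearMap
        (LinearMap.baseChange K f (LinearMap.rTensor X τ⁻¹.toLinearMap z)) =
      LinearMap.baseChange K f z := by
  induction z using TensorProduct.induction_on with
  | zero => simp
  | tmul k x =>
    rw [LinearMap.rTensor_tmul, LinearMap.baseChange_tmul, LinearMap.rTensor_tmul, LinearMap.baseChange_tmul]
    congr 1
    rw [AlgEquiv.toLinearMap_apply, AlgEquiv.toLinearMap_apply, ← AlgEquiv.mul_apply, mul_inv_cancel,
      AlgEquiv.one_apply]
  | add a b ha hb => rw [map_add, map_add, map_add, ha, hb, map_add]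

end Conj

/-! ### §2 The projector over `K`, then over `F₀` -/

section Descent

variable {F₀ K : Type*} [Field F₀] [Field K] [Algebra F₀ K]
variable {VB : Type*} [AddCommGroup VB] [Module K VB] [Module F₀ VB] [IsScalarTower F₀ K VB]
variable {ι : Type*} [Fintype ι] [DecidableEq ι] [DecidableEq (K ≃ₐ[F₀] K)]
variable [FiniteDimensional F₀ K] [IsGalois F₀ K]

omit [IsGalois F₀ K] in
/-- **Over `K`**: the base change of `e₀` (the coordinate projection onto the `σ`-line wedges) is a `K`-linear
combination of the base-changed diagonal operators `⋀ⁿ(1 ⊗ A′ b)`. -/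
theorem baseChange_eq_sum_smul_baseChange_diag [LinearOrder (ι × (K ≃ₐ[F₀] K))]
    (A' : (ι → K) → VB →ₗ[K] VB) (e' : Module.Basis (ι × (K ≃ₐ[F₀] K)) K (K ⊗[F₀] VB))
    (he2' : ∀ (x : K ≃ₐ[F₀] K) (i : ι) (b : ι → K),
      LinearMap.lTensor K ((A' b).restrictScalars F₀) (e' (i, x)) = x (b i) • e' (i, x))
    {n : ℕ} (hn : Fintype.card ι = n)
    (Φ' : K ⊗[F₀] ⋀[F₀]^n VB ≃ₗ[K] ⋀[K]^n (K ⊗[F₀] VB))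
    (hΦ' : ∀ (c : K) (w : Fin n → VB),
      Φ' (c ⊗ₜ[F₀] exteriorPower.ιMulti F₀ n w) = c • exteriorPower.ιMulti K n (fun i => (1 : K) ⊗ₜ[F₀] w i))
    (U : (K ≃ₐ[F₀] K) → Set.powersetCard (ι × (K ≃ₐ[F₀] K)) n)
    (hU : ∀ σ, (U σ : Finset (ι × (K ≃ₐ[F₀] K))) = lineSet σ) (hUinj : Function.Injective U)
    (e₀ : ⋀[F₀]^n VB →ₗ[F₀] ⋀[F₀]^n VB)
    (he₀ : ∀ v, (1 : K) ⊗ₜ[F₀] e₀ v = ∑ L ∈ Finset.univ.image U,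
      ((e'.exteriorPower n).map Φ'.symm).repr ((1 : K) ⊗ₜ[F₀] v) L • ((e'.exteriorPower n).map Φ'.symm) L) :
    ∃ (N : ℕ) (lam : Fin N → K) (b : Fin N → (ι → K)),
      LinearMap.baseChange K e₀ =
        ∑ m, lam m • LinearMap.baseChange K (exteriorPower.map n ((A' (b m)).restrictScalars F₀)) := by
  classical
  obtain ⟨E', hE'def⟩ : ∃ E' : Module.Basis (Set.powersetCard (ι × (K ≃ₐ[F₀] K)) n) K (K ⊗[F₀] ⋀[F₀]^n VB),
      E' = (e'.exteriorPower n).map Φ'.symm := ⟨_, rfl⟩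
  rw [← hE'def] at he₀
  have hE' : ∀ s, Φ' (E' s) = exteriorPower.ιMulti_family K n e' s := by
    intro s
    rw [hE'def, Module.Basis.map_apply, LinearEquiv.apply_symm_apply, exteriorPower.basis_apply]
  -- the indicator of the `σ`-lines as a finite combination of eigenvalue vectors
  obtain ⟨N, lam, g, hg⟩ := Submodule.mem_span_set'.mp (indicator_lineSet_mem_span_char hn U hU hUinj)
  choose b hb using fun m => (g m).2
  refine ⟨N, lam, b, ?_⟩
  -- both sides are `K`-linear maps agreeing on the basis `E'`
  apply E'.ext
  intro L
  -- left: the coordinate projection on `E' L`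
  have hleft : LinearMap.baseChange K e₀ (E' L) = (if L ∈ Finset.univ.image U then (1 : K) else 0) • E' L := by
    -- `baseChange K e₀` is the `K`-linear coordinate projection (they agree on the `1 ⊗ v`)
    have hproj : LinearMap.baseChange K e₀ =
        ∑ L' ∈ Finset.univ.image U, (E'.coord L').smulRight (E' L') := by
      apply baseChange_linearMap_ext
      intro v
      rw [LinearMap.baseChange_tmul, he₀, LinearMap.sum_apply]
      refine Finset.sum_congr rfl fun L' _ => ?_
      rw [LinearMap.smulRight_apply, Module.Basis.coord_apply]
    rw [hproj, LinearMap.sum_apply]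
    simp only [LinearMap.smulRight_apply, Module.Basis.coord_apply, Module.Basis.repr_self,
      Finsupp.single_apply]
    by_cases hL : L ∈ Finset.univ.image U
    · rw [if_pos hL, Finset.sum_eq_single L]
      · rw [if_pos rfl]
      · intro L' _ hL'
        rw [if_neg (Ne.symm hL'), zero_smul]
      · intro h
        exact absurd hL h
    · rw [if_neg hL, zero_smul]
      refine Finset.sum_eq_zero fun L' hL' => ?_
      refine (if_neg fun h : L = L' => hL ?_).symm ▸ zero_smul K (E' L')
      rw [h]
      exact hL'
  -- right: each diagonal operator scales `E' L` by its eigenvalue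
  have hright : ∀ m, LinearMap.baseChange K (exteriorPower.map n ((A' (b m)).restrictScalars F₀)) (E' L) =
      (∏ j : Fin n, (Set.powersetCard.ofFinEmbEquiv.symm L j).2
        (b m (Set.powersetCard.ofFinEmbEquiv.symm L j).1)) • E' L := by
    intro m
    apply Φ'.injective
    rw [wedgeBaseChange_naturality n Φ' hΦ' Φ' hΦ', hE', LinearEquiv.map_smul, hE']
    exact map_baseChange_diag_ιMulti_family A' e' he2' n (b m) L
  rw [hleft, LinearMap.sum_apply]
  simp only [LinearMap.smul_apply, hright, smul_smul]
  rw [← Finset.sum_smul]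
  congr 1
  have := congrFun hg L
  rw [Finset.sum_apply] at this
  rw [← this]
  refine Finset.sum_congr rfl fun m _ => ?_
  rw [Pi.smul_apply, smul_eq_mul, ← hb m]

omit [DecidableEq ι] [DecidableEq (K ≃ₐ[F₀] K)] in
/-- **Over `F₀` (the trace average)**: if `1 ⊗ e₀ = Σ_m λ_m • (1 ⊗ f_m)` with `λ_m ∈ K` and `F₀`-linear `f_m`, then
`e₀ = Σ_m Tr(y λ_m) • f_m` for any `y` with `Tr_{K/F₀}(y) = 1` — apply `(τ ⊗ 1) ∘ (y • ·) ∘ (τ⁻¹ ⊗ 1)` and sum over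
`τ ∈ Gal(K/F₀)` (`trace_eq_sum_automorphisms`). -/
theorem eq_sum_smul_of_baseChange_eq_sum_smul_baseChange {X : Type*} [AddCommGroup X] [Module F₀ X]
    (e₀ : X →ₗ[F₀] X) {N : ℕ} (lam : Fin N → K) (f : Fin N → (X →ₗ[F₀] X))
    (h : LinearMap.baseChange K e₀ = ∑ m, lam m • LinearMap.baseChange K (f m)) :
    ∃ q : Fin N → F₀, e₀ = ∑ m, q m • f m := by
  classical
  obtain ⟨y, hy⟩ := Algebra.trace_surjective (K := F₀) (L := K) (1 : F₀)
  refine ⟨fun m => Algebra.trace F₀ K (y * lam m), ?_⟩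
  apply LinearMap.ext
  intro v
  apply tmul_one_injective (F₀ := F₀) (K := K)
  -- the conjugated identity for each `τ`
  have hτ : ∀ τ : K ≃ₐ[F₀] K, τ y • ((1 : K) ⊗ₜ[F₀] e₀ v) =
      ∑ m, τ (y * lam m) • ((1 : K) ⊗ₜ[F₀] f m v) := by
    intro τ
    have h1 : LinearMap.baseChange K e₀ (LinearMap.rTensor X τ⁻¹.toLinearMap ((1 : K) ⊗ₜ[F₀] v)) =
        ∑ m, lam m • LinearMap.baseChange K (f m) (LinearMap.rTensor X τ⁻¹.toLinearMap ((1 : K) ⊗ₜ[F₀] v)) := by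
      rw [h, LinearMap.sum_apply]
      simp only [LinearMap.smul_apply]
    have h2 := congrArg (fun z => LinearMap.rTensor X τ.toLinearMap (y • z)) h1
    rw [rTensor_smul, rTensor_baseChange_rTensor_inv, Finset.smul_sum, map_sum] at h2
    rw [LinearMap.baseChange_tmul] at h2
    rw [h2]
    refine Finset.sum_congr rfl fun m _ => ?_
    rw [smul_smul, rTensor_smul, rTensor_baseChange_rTensor_inv, LinearMap.baseChange_tmul, map_mul]
  -- sum over `τ`
  have hsum := Finset.sum_congr rfl fun τ (_ : τ ∈ Finset.univ) => hτ τ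
  rw [← Finset.sum_smul, ← trace_eq_sum_automorphisms, hy, map_one, one_smul, Finset.sum_comm] at hsum
  rw [hsum, LinearMap.sum_apply, TensorProduct.tmul_sum]
  refine Finset.sum_congr rfl fun m _ => ?_
  rw [← Finset.sum_smul, ← trace_eq_sum_automorphisms, LinearMap.smul_apply, TensorProduct.tmul_smul,
    algebraMap_smul]

/-- **(S2) as linear algebra: the rational projector onto the Weil line is an `F₀`-linear combination of the diagonal
operators `⋀ⁿ(A′ b)`, `b ∈ K^ι`** (LEMMA-R-RESIDUE.md §4(c), the descent «`e ∈ R ⊗ 1 = R`»).  Hypotheses as in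
`baseChange_eq_sum_smul_baseChange_diag`. -/
theorem exists_eq_sum_smul_map_diag [LinearOrder (ι × (K ≃ₐ[F₀] K))]
    (A' : (ι → K) → VB →ₗ[K] VB) (e' : Module.Basis (ι × (K ≃ₐ[F₀] K)) K (K ⊗[F₀] VB))
    (he2' : ∀ (x : K ≃ₐ[F₀] K) (i : ι) (b : ι → K),
      LinearMap.lTensor K ((A' b).restrictScalars F₀) (e' (i, x)) = x (b i) • e' (i, x))
    {n : ℕ} (hn : Fintype.card ι = n)
    (Φ' : K ⊗[F₀] ⋀[F₀]^n VB ≃ₗ[K] ⋀[K]^n (K ⊗[F₀] VB))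
    (hΦ' : ∀ (c : K) (w : Fin n → VB),
      Φ' (c ⊗ₜ[F₀] exteriorPower.ιMulti F₀ n w) = c • exteriorPower.ιMulti K n (fun i => (1 : K) ⊗ₜ[F₀] w i))
    (U : (K ≃ₐ[F₀] K) → Set.powersetCard (ι × (K ≃ₐ[F₀] K)) n)
    (hU : ∀ σ, (U σ : Finset (ι × (K ≃ₐ[F₀] K))) = lineSet σ) (hUinj : Function.Injective U)
    (e₀ : ⋀[F₀]^n VB →ₗ[F₀] ⋀[F₀]^n VB)
    (he₀ : ∀ v, (1 : K) ⊗ₜ[F₀] e₀ v = ∑ L ∈ Finset.univ.image U,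
      ((e'.exteriorPower n).map Φ'.symm).repr ((1 : K) ⊗ₜ[F₀] v) L • ((e'.exteriorPower n).map Φ'.symm) L) :
    ∃ (N : ℕ) (q : Fin N → F₀) (b : Fin N → (ι → K)),
      e₀ = ∑ m, q m • exteriorPower.map n ((A' (b m)).restrictScalars F₀) := by
  obtain ⟨N, lam, b, h⟩ := baseChange_eq_sum_smul_baseChange_diag A' e' he2' hn Φ' hΦ' U hU hUinj e₀ he₀
  obtain ⟨q, hq⟩ := eq_sum_smul_of_baseChange_eq_sum_smul_baseChange e₀ lam
    (fun m => exteriorPower.map n ((A' (b m)).restrictScalars F₀)) h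
  exact ⟨N, q, b, hq⟩

end Descent

/-! ### §3 The same for `act(a) ∘ e₀` -/

section Act

variable {F₀ K : Type*} [Field F₀] [Field K] [Algebra F₀ K]
variable {VB : Type*} [AddCommGroup VB] [Module K VB] [Module F₀ VB] [IsScalarTower F₀ K VB]
variable {ι : Type*} [Fintype ι] [DecidableEq ι]

omit [Fintype ι] [DecidableEq ι] in
/-- The diagonal action is multiplicative: `A′ b ∘ A′ b′ = A′ (b · b′)` for `A′ b = ω′.constr K (b i • ω′ i)`. -/
theorem diag_comp_diag (ω' : Module.Basis ι K VB) (b b' : ι → K) :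
    ((ω'.constr K fun i => b i • ω' i).restrictScalars F₀) ∘ₗ ((ω'.constr K fun i => b' i • ω' i).restrictScalars F₀) =
      (ω'.constr K fun i => (b * b') i • ω' i).restrictScalars F₀ := by
  apply LinearMap.ext
  intro v
  simp only [LinearMap.comp_apply, LinearMap.restrictScalars_apply]
  have : (ω'.constr K fun i => b i • ω' i) ∘ₗ (ω'.constr K fun i => b' i • ω' i) =
      ω'.constr K fun i => (b * b') i • ω' i := by
    apply ω'.ext
    intro i
    rw [LinearMap.comp_apply, Module.Basis.constr_basis, map_smul, Module.Basis.constr_basis,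
      Module.Basis.constr_basis, smul_smul, Pi.mul_apply, mul_comm]
  exact LinearMap.congr_fun this v

omit [Fintype ι] in
/-- **`act(a) ∘ e₀` is an `F₀`-linear combination of diagonal operators** whenever `e₀` is: with
`e₀ = Σ_m q_m • ⋀ⁿ(A′ b_m)` and `act(a) = ⋀ⁿ(A′ (a at i₀, 1 elsewhere))`,
`act(a) ∘ e₀ = Σ_m q_m • ⋀ⁿ(A′ ((a at i₀, 1 elsewhere) · b_m))`. -/
theorem map_comp_eq_sum_smul_map_diag (ω' : Module.Basis ι K VB) (n : ℕ) (i₀ : ι) (a : K)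
    (e₀ : ⋀[F₀]^n VB →ₗ[F₀] ⋀[F₀]^n VB) {N : ℕ} (q : Fin N → F₀) (b : Fin N → (ι → K))
    (he₀ : e₀ = ∑ m, q m • exteriorPower.map n ((ω'.constr K fun i => b m i • ω' i).restrictScalars F₀)) :
    exteriorPower.map n ((ω'.constr K fun i => Function.update (fun _ => (1 : K)) i₀ a i • ω' i).restrictScalars F₀)
        ∘ₗ e₀ =
      ∑ m, q m • exteriorPower.map n
        ((ω'.constr K fun i => (Function.update (fun _ => (1 : K)) i₀ a * b m) i • ω' i).restrictScalars F₀) := by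
  rw [he₀]
  apply LinearMap.ext
  intro v
  simp only [LinearMap.comp_apply, LinearMap.sum_apply, map_sum, LinearMap.smul_apply, map_smul]
  refine Finset.sum_congr rfl fun m _ => ?_
  rw [← LinearMap.comp_apply (exteriorPower.map n _) (exteriorPower.map n _), ← exteriorPower.map_comp,
    diag_comp_diag]

end Act

end HodgeRepro.Tier3
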